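import Mathlib
import Literature.NumberTheory.LFunctions.Zhang2022.DeltaContourShift
import Literature.NumberTheory.LFunctions.Zhang2022.Section16Eq164Mellin
import Literature.NumberTheory.LFunctions.Zhang2022.TypedSection16ALeaves
import Literature.NumberTheory.LFunctions.Zhang2022.AppendixAKappa2PrimePowers
import Literature.NumberTheory.LFunctions.Zhang2022.Section8Lemma82
import Literature.NumberTheory.LFunctions.Zhang2022.Section14GaussSums
import Literature.NumberTheory.LFunctions.Zhang2022.SkeletonWindowPowers
import Literature.NumberTheory.LFunctions.Zhang2022.Section7Step7u033Repaired
import Literature.NumberTheory.LFunctions.Zhang2022.Section16AU018OfU015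
import HarnessLib

/-!
# Zhang (2022) §16 p. 90, node `Z22:§16.u015`: the contour shift of (16.4) to the exceptional zero
# — `Σ_{(l₁,d₂k)=1} κ₂(d₁l₁)χ(l₁)Δ(l₁l₂/(Dpk)) = ℛ₂*(Dpk/l₂)κ̃₂(d₁;d₂k)λ₂(d₁d₂k) + O(α¹⁰⁰τ₂(d₁)Dpk/l₂)` —
# DISCHARGED (as printed, and on the whole support of `b₁`)

Topic `Literature/NumberTheory/LFunctions/Zhang2022` (Landau–Siegel audit tree; verdict-neutral).
Y. Zhang, *Discrete mean estimates and the Landau–Siegel zero*, arXiv:2211.02515v1 (2022)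
[Zhang2022LandauSiegel] — **an unrefereed manuscript under adjudication** (ZHANG-L discharge lane, WP16
leaf `Typed.Section16A.Eq16_12 c′`). Node `Z22:§16.u015` [Z22 p. 90, tex L4484], typed AS PRINTED as
`Typed.Section16A.Step16_u015`: "Note that `Dpk/l₂ > T` if `l₂ < P₂²`. In a way similar to the treatment
of (7.19) … the expression (16.4) is equal to the residue of the integrand at `s = ρ̃` plus an acceptable
error. Further, by (5.15), we can replace `ρ̃` by `1` … Thus `Σ_{(l₁,d₂k)=1} κ₂(d₁l₁)χ(l₁)Δ(l₁l₂/(Dpk))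
= ℛ₂*(Dpk/l₂)κ̃₂(d₁;d₂k)λ₂(d₁d₂k) + O(α¹⁰⁰τ₂(d₁)Dpk/l₂)`".

This file instantiates the engine `DeltaContourShift.deltaContourShift` (p478719) with
`G(s) = κ̃₂(d₁;d₂k,s)·λ₂(d₁d₂k,s)·L(s+β₁,χ)` and `y = Dpk/l₂`, after (16.4) (`eq16_4_holds`) and u012
(`step16_u012_holds`: the Mellin integrand of (16.4) is `G(s)L(s,χ)⁻¹yˢδ(s)` on `σ = 2`):

* `differentiableOn_kappaTilde2_of_re`, `norm_kappaTilde2_le_prod_inv` — `κ̃₂(d₁;r,·)` is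
  holomorphic on `σ > 9/10` and `|κ̃₂(d₁;r,s)| ≤ 2^{ω(d₁)}∏_{q∣d₁}(1 − q^{−σ₀})⁻¹` for `Re s ≥ σ₀ > 0`
  (Euler product over the `d₁`-factored numbers, `|κ₂(N)| ≤ 2^{ω(N)}`); `differentiableAt_lam2`,
  `norm_lam2_le_prod_eight` — `λ₂(n,·)` is holomorphic on `σ > 0` with
  `|λ₂(n,s)| ≤ ∏_{q∣n}(1 + 8q^{−σ})` (`σ ≥ 1/2`). (Twins with other constants were landed
  concurrently in `Section16AKappaTilde2Analytic.lean`.)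
* `norm_G_le` — on the contour region `{1 − 1/(16𝓛) ≤ σ ≤ 2} ∩ ({|t| ≤ D+1} ∪ {σ ≥ 1+α})`:
  `‖G(s)‖ ≤ τ₂(d₁)·2²⁵e¹⁴⁴·𝓛³³` — POINTWISE polynomial in `𝓛`, uniformly in `d₂, k` (for `d₁d₂k < P`):
  on `σ ≥ 1 − 1/(16𝓛)` the Euler-product weights `∏_{q∣n}(1 + Cq^{−σ})` are `≪ 𝓛^{2C}` by the tree's
  `Lemma84.prod_primeFactors_le` (primes `≤ D²` via Mertens, the `≤ 2𝓛⁹` larger ones via `q^{−σ} ≤ e^{1/4}/D²`),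
  so NO Euler-product weight survives in the error (contrast the weight of G-d24-1, which arises from
  bounds taken on `σ = 9/10`);
* `step16_u015_master` — the display with error `C·τ₂(d₁)·𝓛⁻¹⁹⁰⁰·Dpk/l₂` for ALL `l₂ ≥ 1` with
  `l₂T ≤ Dpk` and `d₁d₂k < 2P₄`;
* `step16_u015_holds : Step16_u015 c'` — **node `Z22:§16.u015` DISCHARGED as printed** (`l₂ < P₂²`,
  `α¹⁰⁰ = π¹⁰⁰𝓛⁻⁹⁰⁰ ≥ 𝓛⁻¹⁹⁰⁰`);
* `step16_u015ww_holds` — the same on the support of `b₁` (`l₂ < 2T²P^{1/2}max(P₂,P₃)`) in the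
  weighted/polynomial shape consumed by `Typed.Section16A.step16_u018w_of_u015ww` (weight exponent
  `c₀ = 0`, rate `𝓛⁻²⁰⁰`).

No new definitions, no named facts, no `sorry`. CONDITIONAL on (A) exactly as the manuscript; nothing
here bears on Theorems 1–2 of the source or on Landau–Siegel zeros.

## References

* Y. Zhang, arXiv:2211.02515v1 (2022), §16 p. 90 (u012–u015, (16.4)), tex L4466–L4490; §7 p. 40;
  §5 Lemma 5.5, (5.15). [cite: Zhang2022LandauSiegel, §16 p.90 (u015)]
-/

noncomputable section

open Complex Real MeasureTheory Set Filter Topology Metric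
open Literature.NumberTheory.LFunctions.Zhang2022
open Literature.NumberTheory.LFunctions.Zhang2022.Skeleton

namespace Literature.NumberTheory.LFunctions.Zhang2022.Typed.Section16A

/-! ## §1. `κ̃₂(d₁;r,s)`: holomorphy and a bound uniform in `Im s` -/

section KappaTilde

variable (c' : ℝ) {D : ℕ} (χ : DirichletCharacter ℂ D)

/-- `𝔫(m)` (`m ≥ 1`) is Mathlib's set of `m.primeFactors`-factored numbers. [folklore] -/
private theorem mem_nset_iff_factoredNumbers' {m h : ℕ} (hm : m ≠ 0) :
    h ∈ nset m ↔ h ∈ Nat.factoredNumbers m.primeFactors := by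
  rw [Nat.mem_factoredNumbers_iff_primeFactors_subset]
  constructor
  · rintro ⟨hpos, hdiv⟩
    refine ⟨hpos.ne', fun q hq => ?_⟩
    have hq' := Nat.mem_primeFactors.mp hq
    exact Nat.mem_primeFactors.mpr ⟨hq'.1, hdiv q hq'.1 hq'.2.1, hm⟩
  · rintro ⟨h0, hsub⟩
    refine ⟨Nat.pos_of_ne_zero h0, fun q hq hqh => ?_⟩
    exact (Nat.mem_primeFactors.mp (hsub (Nat.mem_primeFactors.mpr ⟨hq, hqh, h0⟩))).2.1

/-- `|κ₂(N)| ≤ 2^{ω(N)}` (`N ≥ 1`): `κ₂` is multiplicative with `|κ₂(qʲ)| ≤ 2`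
(`AppendixA.norm_kappa₂_prime_pow_le_two`). [cite: Zhang2022LandauSiegel, App. A p.105] -/
private theorem norm_kappa2_le_two_pow' {N : ℕ} (hN : N ≠ 0) :
    ‖kappa2 c' D N‖ ≤ 2 ^ N.primeFactors.card := by
  have hmul := MeanSquareMajorant.isMultiplicative_kappa₂ (b1 c' D)
  unfold kappa2
  rw [hmul.multiplicative_factorization _ hN, Finsupp.prod, Nat.support_factorization, norm_prod]
  calc ∏ p ∈ N.primeFactors, ‖MeanSquareMajorant.kappa₂ (b1 c' D) (p ^ N.factorization p)‖
      ≤ ∏ _p ∈ N.primeFactors, (2 : ℝ) :=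
        Finset.prod_le_prod (fun _ _ => norm_nonneg _) fun p hp =>
          AppendixA.norm_kappa₂_prime_pow_le_two _ (Nat.prime_of_mem_primeFactors hp) _
    _ = 2 ^ N.primeFactors.card := Finset.prod_const 2

/-- **`Σ_{h∈𝔫(m)} h^{−σ₀} = ∏_{q∣m}(1 − q^{−σ₀})⁻¹`** (`m ≥ 1`, `σ₀ > 0`): the Euler product of the
completely multiplicative `h ↦ h^{−σ₀}` over the `m`-factored numbers. [folklore] -/
private theorem hasSum_nset_rpow (m : ℕ) {σ₀ : ℝ} (hσ : 0 < σ₀) :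
    HasSum ((Nat.factoredNumbers m.primeFactors).indicator fun h : ℕ => (h : ℝ) ^ (-σ₀))
      (∏ q ∈ m.primeFactors, (1 - (q : ℝ) ^ (-σ₀))⁻¹) := by
  let f : ℕ →* ℝ :=
    { toFun := fun n => (n : ℝ) ^ (-σ₀)
      map_one' := by simp
      map_mul' := fun a b => by
        push_cast
        exact Real.mul_rpow (Nat.cast_nonneg a) (Nat.cast_nonneg b) }
  have hf : ∀ n : ℕ, f n = (n : ℝ) ^ (-σ₀) := fun n => rfl
  have hlt : ∀ {p : ℕ}, p.Prime → ‖f p‖ < 1 := by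
    intro p hp
    rw [hf, Real.norm_eq_abs, abs_of_nonneg (by positivity)]
    exact Real.rpow_lt_one_of_one_lt_of_neg (by exact_mod_cast hp.one_lt) (by linarith)
  obtain ⟨-, hsum⟩ :=
    EulerProduct.summable_and_hasSum_factoredNumbers_prod_filter_prime_geometric hlt m.primeFactors
  have hfilter : m.primeFactors.filter (fun p => p.Prime) = m.primeFactors :=
    Finset.filter_true_of_mem fun p hp => Nat.prime_of_mem_primeFactors hp
  rw [hfilter] at hsum
  exact hasSum_subtype_iff_indicator.mp hsum

open scoped Classical in
/-- The termwise majorant of `κ̃₂(m;r,s)` on `Re s ≥ σ₀ > 0`: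
`‖κ₂(mh)χ(h)h^{−s}·[h ∈ 𝔫(m), (h,r)=1]‖ ≤ 2^{ω(m)}·h^{−σ₀}·[h ∈ 𝔫(m)]`.
[cite: Zhang2022LandauSiegel, §16 p.90 (u013)] -/
theorem norm_kappaTilde2_term_le {m : ℕ} (hm : m ≠ 0) (r : ℕ) {σ₀ : ℝ} {s : ℂ} (hs : σ₀ ≤ s.re)
    (h : ℕ) :
    ‖(if h ∈ nset m ∧ Nat.Coprime h r then kappa2 c' D (m * h) * χ (h : ZMod D) / (h : ℂ) ^ s else 0)‖
      ≤ 2 ^ m.primeFactors.card *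
        (Nat.factoredNumbers m.primeFactors).indicator (fun h : ℕ => (h : ℝ) ^ (-σ₀)) h := by
  by_cases hc : h ∈ nset m ∧ Nat.Coprime h r
  · rw [if_pos hc]
    have hh0 : 0 < h := hc.1.1
    have hhR : (0 : ℝ) < h := by exact_mod_cast hh0
    have hmem : h ∈ Nat.factoredNumbers m.primeFactors := (mem_nset_iff_factoredNumbers' hm).mp hc.1
    simp only [Set.indicator_of_mem hmem]
    rw [norm_div, norm_mul, Complex.norm_natCast_cpow_of_pos hh0]
    have hκ : ‖kappa2 c' D (m * h)‖ ≤ 2 ^ m.primeFactors.card := by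
      have h1 := norm_kappa2_le_two_pow' c' (D := D) (mul_ne_zero hm hh0.ne')
      have hpf : (m * h).primeFactors = m.primeFactors := by
        rw [Nat.primeFactors_mul hm hh0.ne', Finset.union_eq_left]
        intro q hq
        have hq' := Nat.mem_primeFactors.mp hq
        exact Nat.mem_primeFactors.mpr ⟨hq'.1, hc.1.2 q hq'.1 hq'.2.1, hm⟩
      rwa [hpf] at h1
    have hχ : ‖χ (h : ZMod D)‖ ≤ 1 := DirichletCharacter.norm_le_one χ _
    have hpow : (h : ℝ) ^ (-σ₀) ≥ ((h : ℝ) ^ s.re)⁻¹ := by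
      rw [Real.rpow_neg hhR.le]
      exact inv_anti₀ (Real.rpow_pos_of_pos hhR _)
        (Real.rpow_le_rpow_of_exponent_le (by exact_mod_cast hh0) hs)
    rw [div_eq_mul_inv]
    calc ‖kappa2 c' D (m * h)‖ * ‖χ (h : ZMod D)‖ * ((h : ℝ) ^ s.re)⁻¹
        ≤ 2 ^ m.primeFactors.card * 1 * (h : ℝ) ^ (-σ₀) := by
          gcongr
      _ = 2 ^ m.primeFactors.card * (h : ℝ) ^ (-σ₀) := by rw [mul_one]
  · rw [if_neg hc, norm_zero]
    exact mul_nonneg (by positivity) (Set.indicator_nonneg (fun _ _ => by positivity) _)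

/-- **`κ̃₂(d₁;r,·)` is holomorphic on `σ > 9/10`** (`d₁ ≥ 1`): a locally uniform limit of its partial
sums, dominated by `2^{ω(d₁)}Σ_{h∈𝔫(d₁)}h^{−9/10} < ∞`. [cite: Zhang2022LandauSiegel, §16 p.90 (u013)] -/
theorem differentiableOn_kappaTilde2_of_re [NeZero D] {d₁ : ℕ} (hd₁ : d₁ ≠ 0) (r : ℕ) :
    DifferentiableOn ℂ (fun s => kappaTilde2 c' χ d₁ r s) {s : ℂ | 9 / 10 < s.re} := by
  classical
  have hU : IsOpen {s : ℂ | 9 / 10 < s.re} := isOpen_lt continuous_const Complex.continuous_re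
  have hsum := (hasSum_nset_rpow d₁ (by norm_num : (0 : ℝ) < 9 / 10)).summable.mul_left
    ((2 : ℝ) ^ d₁.primeFactors.card)
  unfold kappaTilde2
  refine differentiableOn_tsum_of_summable_norm hsum (fun h => ?_) hU (fun h w hw => ?_)
  · by_cases hc : h ∈ nset d₁ ∧ Nat.Coprime h r
    · simp only [if_pos hc]
      have hh0 : (h : ℂ) ≠ 0 := by exact_mod_cast hc.1.1.ne'
      intro w _
      refine (DifferentiableAt.div (differentiableAt_const _)
        (differentiableAt_id.const_cpow (Or.inl hh0)) ?_).differentiableWithinAt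
      rw [Ne, cpow_eq_zero_iff, not_and_or]
      exact Or.inl hh0
    · simp only [if_neg hc]
      exact differentiableOn_const _
  · exact norm_kappaTilde2_term_le c' χ hd₁ r (le_of_lt hw) h

/-- **`|κ̃₂(d₁;r,s)| ≤ 2^{ω(d₁)}∏_{q∣d₁}(1 − q^{−σ₀})⁻¹`** for `Re s ≥ σ₀ > 0` (`d₁ ≥ 1`), uniformly in
`Im s` and in `r`. [cite: Zhang2022LandauSiegel, §16 p.90 (u013)] -/
theorem norm_kappaTilde2_le_prod_inv [NeZero D] {d₁ : ℕ} (hd₁ : d₁ ≠ 0) (r : ℕ) {σ₀ : ℝ}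
    (hσ₀ : 0 < σ₀) {s : ℂ} (hs : σ₀ ≤ s.re) :
    ‖kappaTilde2 c' χ d₁ r s‖ ≤
      2 ^ d₁.primeFactors.card * ∏ q ∈ d₁.primeFactors, (1 - (q : ℝ) ^ (-σ₀))⁻¹ := by
  classical
  have hsum := (hasSum_nset_rpow d₁ hσ₀).mul_left ((2 : ℝ) ^ d₁.primeFactors.card)
  unfold kappaTilde2
  exact tsum_of_norm_bounded hsum fun h => norm_kappaTilde2_term_le c' χ hd₁ r hs h

/-- `2^{ω(n)} ≤ τ₂(n)` (`n ≥ 1`). [folklore] -/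
private theorem two_pow_card_primeFactors_le_card_divisors' {n : ℕ} (hn : n ≠ 0) :
    2 ^ n.primeFactors.card ≤ n.divisors.card := by
  rw [Nat.card_divisors hn]
  refine Finset.pow_card_le_prod _ _ _ fun p hp => ?_
  have : 0 < n.factorization p := Nat.Prime.factorization_pos_of_dvd (Nat.prime_of_mem_primeFactors hp)
    hn (Nat.dvd_of_mem_primeFactors hp)
  omega

/-- For a prime `q` and `σ ≥ 1/2`: `0 ≤ q^{−σ} ≤ 3/4` (`q^{−σ} ≤ 2^{−1/2} = 1/√2 ≤ 3/4`). [folklore] -/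
private theorem prime_rpow_neg_le {q : ℕ} (hq : q.Prime) {σ : ℝ} (hσ : 1 / 2 ≤ σ) :
    0 ≤ (q : ℝ) ^ (-σ) ∧ (q : ℝ) ^ (-σ) ≤ 3 / 4 := by
  have hq2 : (2 : ℝ) ≤ q := by exact_mod_cast hq.two_le
  have hq0 : (0 : ℝ) < q := by linarith
  refine ⟨Real.rpow_nonneg hq0.le _, ?_⟩
  have h1 : (q : ℝ) ^ (-σ) ≤ (q : ℝ) ^ (-(1 / 2 : ℝ)) :=
    Real.rpow_le_rpow_of_exponent_le (by linarith) (by linarith)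
  have h2 : (q : ℝ) ^ (-(1 / 2 : ℝ)) ≤ (2 : ℝ) ^ (-(1 / 2 : ℝ)) :=
    Real.rpow_le_rpow_of_nonpos (by norm_num) hq2 (by norm_num)
  have h3 : (2 : ℝ) ^ (-(1 / 2 : ℝ)) ≤ 3 / 4 := by
    rw [Real.rpow_neg (by norm_num : (0 : ℝ) ≤ 2), ← Real.sqrt_eq_rpow]
    rw [inv_le_comm₀ (Real.sqrt_pos.mpr (by norm_num)) (by norm_num)]
    rw [show ((3 : ℝ) / 4)⁻¹ = 4 / 3 by norm_num, Real.le_sqrt (by norm_num)]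
    all_goals norm_num
  linarith

/-- `(1 − x)⁻¹ ≤ 1 + 4x` for `0 ≤ x ≤ 3/4`. [folklore] -/
private theorem inv_one_sub_le {x : ℝ} (h0 : 0 ≤ x) (h1 : x ≤ 3 / 4) : (1 - x)⁻¹ ≤ 1 + 4 * x := by
  have hpos : 0 < 1 - x := by linarith
  rw [inv_le_iff_one_le_mul₀ hpos]
  nlinarith

/-- **`∏_{q∣d₁}(1 − q^{−σ₀})⁻¹ ≤ ∏_{q∣d₁}(1 + 4q^{−σ₀})`** for `σ₀ ≥ 1/2`. [folklore] -/
private theorem prod_inv_one_sub_le (d₁ : ℕ) {σ₀ : ℝ} (hσ₀ : 1 / 2 ≤ σ₀) :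
    ∏ q ∈ d₁.primeFactors, (1 - (q : ℝ) ^ (-σ₀))⁻¹ ≤
      ∏ q ∈ d₁.primeFactors, (1 + 4 * (q : ℝ) ^ (-σ₀)) := by
  refine Finset.prod_le_prod (fun q hq => ?_) fun q hq => ?_
  · obtain ⟨h0, h1⟩ := prime_rpow_neg_le (Nat.prime_of_mem_primeFactors hq) hσ₀
    exact inv_nonneg.mpr (by linarith)
  · obtain ⟨h0, h1⟩ := prime_rpow_neg_le (Nat.prime_of_mem_primeFactors hq) hσ₀
    exact inv_one_sub_le h0 h1

end KappaTilde

/-! ## §2. `λ₂(n,s)`: holomorphy on `σ > 0` and the bound `∏_{q∣n}(1 + 8q^{−σ})` -/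

section Lam

variable (c' : ℝ) {D : ℕ} (χ : DirichletCharacter ℂ D)

/-- `Re β₁ = 0` (`β₁ = i·b₁`). [cite: Zhang2022LandauSiegel, §2 (2.13)] -/
private theorem beta1_re' (D : ℕ) : (beta1 c' D).re = 0 := by
  rw [beta1_eq_b1_mul_I]; simp

/-- `‖χ(q)q^{−w}‖ ≤ q^{−Re w}` for `q ≥ 1`. [folklore] -/
private theorem norm_chi_mul_cpow_le {q : ℕ} (hq : 0 < q) (w : ℂ) :
    ‖χ (q : ZMod D) * (q : ℂ) ^ (-w)‖ ≤ (q : ℝ) ^ (-w.re) := by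
  rw [norm_mul, Complex.norm_natCast_cpow_of_pos hq, Complex.neg_re]
  calc ‖χ (q : ZMod D)‖ * (q : ℝ) ^ (-w.re) ≤ 1 * (q : ℝ) ^ (-w.re) :=
        mul_le_mul_of_nonneg_right (DirichletCharacter.norm_le_one χ _) (Real.rpow_nonneg (by positivity) _)
    _ = (q : ℝ) ^ (-w.re) := one_mul _

/-- **`λ₂(n,·)` is holomorphic at every `s` with `Re s > 0`** (a finite product; the denominators
`1 − χ(q)q^{−s}` do not vanish since `|χ(q)q^{−s}| ≤ q^{−σ} < 1`). [cite: Zhang2022LandauSiegel, §16 p.90 (u014)] -/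
theorem differentiableAt_lam2 (n : ℕ) {s : ℂ} (hs : 0 < s.re) :
    DifferentiableAt ℂ (fun w => lam2 c' χ n w) s := by
  unfold lam2
  refine DifferentiableAt.fun_finsetProd fun q hq => ?_
  have hqp := Nat.prime_of_mem_primeFactors hq
  have hq0 : (q : ℂ) ≠ 0 := by exact_mod_cast hqp.ne_zero
  have hnum : DifferentiableAt ℂ (fun w => 1 - χ (q : ZMod D) * (q : ℂ) ^ (-(w + beta1 c' D))) s :=
    (differentiableAt_const _).sub ((differentiableAt_const _).mul
      (((differentiableAt_id.add_const _).neg).const_cpow (Or.inl hq0)))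
  have hden : DifferentiableAt ℂ (fun w => 1 - χ (q : ZMod D) * (q : ℂ) ^ (-w)) s :=
    (differentiableAt_const _).sub ((differentiableAt_const _).mul
      ((differentiableAt_id.neg).const_cpow (Or.inl hq0)))
  refine hnum.div hden ?_
  have hlt : ‖χ (q : ZMod D) * (q : ℂ) ^ (-s)‖ < 1 := by
    refine lt_of_le_of_lt (norm_chi_mul_cpow_le χ hqp.pos s) ?_
    exact Real.rpow_lt_one_of_one_lt_of_neg (by exact_mod_cast hqp.one_lt) (by linarith)
  intro h
  have : ‖χ (q : ZMod D) * (q : ℂ) ^ (-s)‖ = 1 := by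
    rw [sub_eq_zero] at h; rw [← h, norm_one]
  linarith

/-- `(1 + x)/(1 − x) ≤ 1 + 8x` for `0 ≤ x ≤ 3/4`. [folklore] -/
private theorem one_add_div_one_sub_le {x : ℝ} (h0 : 0 ≤ x) (h1 : x ≤ 3 / 4) :
    (1 + x) / (1 - x) ≤ 1 + 8 * x := by
  have hpos : 0 < 1 - x := by linarith
  rw [div_le_iff₀ hpos]
  nlinarith

/-- **`|λ₂(n,s)| ≤ ∏_{q∣n}(1 + 8q^{−σ})`** for `σ = Re s ≥ 1/2` (each factor has modulus
`≤ (1 + q^{−σ})/(1 − q^{−σ})`, `Re β₁ = 0`). [cite: Zhang2022LandauSiegel, §16 p.90 (u014)] -/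
theorem norm_lam2_le_prod_eight (n : ℕ) {s : ℂ} (hs : 1 / 2 ≤ s.re) :
    ‖lam2 c' χ n s‖ ≤ ∏ q ∈ n.primeFactors, (1 + 8 * (q : ℝ) ^ (-s.re)) := by
  unfold lam2
  rw [norm_prod]
  refine Finset.prod_le_prod (fun _ _ => norm_nonneg _) fun q hq => ?_
  have hqp := Nat.prime_of_mem_primeFactors hq
  obtain ⟨hx0, hx1⟩ := prime_rpow_neg_le hqp hs
  set x : ℝ := (q : ℝ) ^ (-s.re) with hx
  have ha : ‖χ (q : ZMod D) * (q : ℂ) ^ (-(s + beta1 c' D))‖ ≤ x := by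
    have h := norm_chi_mul_cpow_le χ hqp.pos (s + beta1 c' D)
    rwa [Complex.add_re, beta1_re', add_zero] at h
  have hb : ‖χ (q : ZMod D) * (q : ℂ) ^ (-s)‖ ≤ x := norm_chi_mul_cpow_le χ hqp.pos s
  have hnum : ‖1 - χ (q : ZMod D) * (q : ℂ) ^ (-(s + beta1 c' D))‖ ≤ 1 + x := by
    calc ‖1 - χ (q : ZMod D) * (q : ℂ) ^ (-(s + beta1 c' D))‖
        ≤ ‖(1 : ℂ)‖ + ‖χ (q : ZMod D) * (q : ℂ) ^ (-(s + beta1 c' D))‖ := norm_sub_le _ _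
      _ ≤ 1 + x := by rw [norm_one]; gcongr
  have hden : 1 - x ≤ ‖1 - χ (q : ZMod D) * (q : ℂ) ^ (-s)‖ := by
    have h := norm_sub_norm_le (1 : ℂ) (χ (q : ZMod D) * (q : ℂ) ^ (-s))
    rw [norm_one] at h
    linarith
  have hden0 : 0 < 1 - x := by linarith
  rw [norm_div]
  calc ‖1 - χ (q : ZMod D) * (q : ℂ) ^ (-(s + beta1 c' D))‖ / ‖1 - χ (q : ZMod D) * (q : ℂ) ^ (-s)‖
      ≤ (1 + x) / (1 - x) := by
        rw [div_le_div_iff₀ (lt_of_lt_of_le hden0 hden) hden0]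
        calc ‖1 - χ (q : ZMod D) * (q : ℂ) ^ (-(s + beta1 c' D))‖ * (1 - x)
            ≤ (1 + x) * (1 - x) := mul_le_mul_of_nonneg_right hnum hden0.le
          _ ≤ (1 + x) * ‖1 - χ (q : ZMod D) * (q : ℂ) ^ (-s)‖ :=
              mul_le_mul_of_nonneg_left hden (by linarith)
    _ ≤ 1 + 8 * x := one_add_div_one_sub_le hx0 hx1

end Lam

/-! ## §3. The factor `G = κ̃₂·λ₂·L(·+β₁,χ)` on the contour region: holomorphy and a pointwise
polynomial bound -/

section GBound

variable (c' : ℝ) {D : ℕ} [NeZero D] (χ : DirichletCharacter ℂ D)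

/-- `‖β₁‖ ≤ (1 + 5|c′|)/𝓛` (`β₁ = iα(1 − 5c′α𝓛)`, `α ≤ 𝓛⁻¹`); in particular `‖β₁‖ ≤ 1` once
`𝓛 ≥ 1 + 5|c′|`. [cite: Zhang2022LandauSiegel, §2 (2.13)] -/
theorem norm_beta1_le_one {D : ℕ} (hℓ4 : 4 ≤ ell D) (hℓc : 1 + 5 * |c'| ≤ ell D) :
    ‖beta1 c' D‖ ≤ 1 := by
  obtain ⟨-, -, -, hα0, hαℓ, -, -, -, -⟩ := DeltaContourShift.param_facts hℓ4
  have hℓ0 : 0 < ell D := by linarith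
  rw [beta1_eq_b1_mul_I, norm_mul, Complex.norm_I, mul_one, Complex.norm_real, Real.norm_eq_abs, b1]
  have hαℓ1 : alpha D * ell D ≤ 1 := by
    calc alpha D * ell D ≤ (ell D)⁻¹ * ell D := mul_le_mul_of_nonneg_right hαℓ hℓ0.le
      _ = 1 := inv_mul_cancel₀ hℓ0.ne'
  rw [abs_mul, abs_of_pos hα0]
  have h1 : |1 - 5 * c' * alpha D * ell D| ≤ 1 + 5 * |c'| := by
    calc |1 - 5 * c' * alpha D * ell D| ≤ |(1 : ℝ)| + |5 * c' * alpha D * ell D| := abs_sub _ _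
      _ = 1 + 5 * |c'| * (alpha D * ell D) := by
          rw [abs_one, show 5 * c' * alpha D * ell D = 5 * c' * (alpha D * ell D) by ring, abs_mul,
            abs_mul, abs_of_nonneg (by positivity : (0 : ℝ) ≤ alpha D * ell D)]
          norm_num
      _ ≤ 1 + 5 * |c'| * 1 := by gcongr
      _ = 1 + 5 * |c'| := by ring
  calc alpha D * |1 - 5 * c' * alpha D * ell D| ≤ (ell D)⁻¹ * (1 + 5 * |c'|) :=
        mul_le_mul hαℓ h1 (abs_nonneg _) (by positivity)
    _ ≤ (ell D)⁻¹ * ell D := by gcongr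
    _ = 1 := inv_mul_cancel₀ hℓ0.ne'

/-- **`‖L(s+β₁,χ)‖ ≤ 2𝓛⁹` on the contour region** `{1 − 1/(16𝓛) ≤ σ ≤ 2} ∩ ({|t| ≤ D+1} ∪
{σ ≥ 1+α})` (`𝓛 ≥ 8`, `𝓛 ≥ 1 + 5|c′|`, `χ ≠ χ₀`): right of `1 + α` by `ζ(1+α) ≤ 1 + 1/α = 1 + 𝓛⁹/π`
(tree `Lemma84.norm_LFunction_le_right'`); on `σ ≥ 1`, `|t| ≤ D+1` by `3 + log D + log(|s+β₁|+1)`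
(tree `Section8Floor.norm_LFunction_le_right`); on `1 − 1/(16𝓛) ≤ σ < 1` by the convexity-type bound
`(D(|s+β₁|+1))^{1−σ}(4 + log D + log(|s+β₁|+1))` (tree `Lemma82.norm_LFunction_le_left`) with
`(D³)^{1/(16𝓛)} = e^{3/16}`. [cite: Zhang2022LandauSiegel, §16 p.90 (u015)] -/
theorem norm_LFunction_shift_le (hχ : χ ≠ 1) (hℓ8 : 8 ≤ ell D) (hℓc : 1 + 5 * |c'| ≤ ell D) {s : ℂ}
    (hs1 : 1 - 1 / (16 * ell D) ≤ s.re) (hs2 : s.re ≤ 2)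
    (hs3 : |s.im| ≤ (D : ℝ) + 1 ∨ 1 + alpha D ≤ s.re) :
    ‖χ.LFunction (s + beta1 c' D)‖ ≤ 2 * ell D ^ 9 := by
  have hℓ4 : 4 ≤ ell D := by linarith only [hℓ8]
  have hℓ1 : 1 ≤ ell D := by linarith only [hℓ8]
  have hℓ0 : 0 < ell D := by linarith only [hℓ8]
  obtain ⟨hD3r, hD3, hDexp, hα0, hαℓ, hℓinv, hαlogP, hlogP, hαval⟩ := DeltaContourShift.param_facts hℓ4
  have hβ := norm_beta1_le_one c' hℓ4 hℓc
  have hβre : (beta1 c' D).re = 0 := beta1_re' c' D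
  have hre : (s + beta1 c' D).re = s.re := by rw [Complex.add_re, hβre, add_zero]
  have hℓ9 : (1 : ℝ) ≤ ell D ^ 9 := one_le_pow₀ hℓ1
  have hℓ9' : ell D ≤ ell D ^ 9 := le_self_pow₀ hℓ1 (by norm_num)
  have hbig : 100 * ell D ≤ ell D ^ 9 := by
    have h8 : (8 : ℝ) ^ 8 ≤ ell D ^ 8 := pow_le_pow_left₀ (by norm_num) hℓ8 8
    have h100 : (100 : ℝ) ≤ ell D ^ 8 := le_trans (by norm_num) h8
    calc 100 * ell D ≤ ell D ^ 8 * ell D := mul_le_mul_of_nonneg_right h100 hℓ0.le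
      _ = ell D ^ 9 := by ring
  have h16 : 1 / (16 * ell D) ≤ 1 / 16 := by
    apply div_le_div_of_nonneg_left (by norm_num) (by norm_num); linarith only [hℓ1]
  -- the right region first
  by_cases hfar : 1 + alpha D ≤ s.re
  · have h := Lemma84.norm_LFunction_le_right' χ hα0 (s := s + beta1 c' D) (by rw [hre]; exact hfar)
    refine h.trans ?_
    have hsplit : (1 + alpha D) / alpha D = 1 / alpha D + 1 := by field_simp
    rw [hsplit, hαval, one_div_div]
    have h1 : ell D ^ 9 / π ≤ ell D ^ 9 := div_le_self (by positivity) (by linarith only [Real.pi_gt_three])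
    linarith only [h1, hℓ9]
  -- the near region `|t| ≤ D + 1`
  have ht : |s.im| ≤ (D : ℝ) + 1 := by
    rcases hs3 with h | h
    · exact h
    · exact absurd h hfar
  have hnorm : ‖s + beta1 c' D‖ + 1 ≤ (D : ℝ) + 5 := by
    have h1 : ‖s‖ ≤ |s.re| + |s.im| := Complex.norm_le_abs_re_add_abs_im s
    have h2 : |s.re| ≤ 2 := by
      rw [abs_le]; constructor <;> linarith only [hs1, hs2, h16]
    have h3 : ‖s + beta1 c' D‖ ≤ ‖s‖ + ‖beta1 c' D‖ := norm_add_le _ _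
    linarith only [h1, h2, h3, ht, hβ]
  have hD5 : (D : ℝ) + 5 ≤ (D : ℝ) ^ 3 := by
    have h33 : (3 : ℝ) * 3 ≤ (D : ℝ) * D := mul_le_mul hD3r hD3r (by norm_num) (by linarith)
    have h9D : 9 * (D : ℝ) ≤ (D : ℝ) * D * D := mul_le_mul_of_nonneg_right (by linarith) (by linarith)
    have : (D : ℝ) ^ 3 = (D : ℝ) * D * D := by ring
    rw [this]; linarith
  have hlog5 : Real.log (‖s + beta1 c' D‖ + 1) ≤ 3 * ell D := by
    have hpos : 0 < ‖s + beta1 c' D‖ + 1 := by positivity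
    calc Real.log (‖s + beta1 c' D‖ + 1) ≤ Real.log ((D : ℝ) ^ 3) :=
          Real.log_le_log hpos (hnorm.trans hD5)
      _ = 3 * ell D := by rw [Real.log_pow, ell]; norm_num
  have hlogD : Real.log (D : ℝ) = ell D := rfl
  by_cases hσ1 : 1 ≤ s.re
  · have h := Section8Floor.norm_LFunction_le_right χ hχ (s := s + beta1 c' D) (by rw [hre]; exact hσ1)
    rw [hlogD] at h
    linarith only [h, hlog5, hbig, hℓ1]
  · rw [not_le] at hσ1
    have h := Lemma82.norm_LFunction_le_left χ hχ (s := s + beta1 c' D)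
      (by rw [hre]; linarith only [hs1, h16]) (by rw [hre]; exact hσ1.le)
    rw [hlogD, hre] at h
    refine h.trans ?_
    -- the base and the exponent
    have hB1 : (1 : ℝ) ≤ (D : ℝ) * (‖s + beta1 c' D‖ + 1) := by
      have : (1 : ℝ) ≤ ‖s + beta1 c' D‖ + 1 := by linarith [norm_nonneg (s + beta1 c' D)]
      nlinarith
    have hB3 : (D : ℝ) * (‖s + beta1 c' D‖ + 1) ≤ (D : ℝ) ^ 3 * (D : ℝ) ^ 3 := by
      have h1 : (D : ℝ) ≤ (D : ℝ) ^ 3 := by nlinarith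
      exact mul_le_mul h1 (hnorm.trans hD5) (by positivity) (by positivity)
    have hexp : 1 - s.re ≤ 1 / (16 * ell D) := by linarith
    have hpow : ((D : ℝ) * (‖s + beta1 c' D‖ + 1)) ^ (1 - s.re) ≤ 3 := by
      calc ((D : ℝ) * (‖s + beta1 c' D‖ + 1)) ^ (1 - s.re)
          ≤ ((D : ℝ) * (‖s + beta1 c' D‖ + 1)) ^ (1 / (16 * ell D)) :=
            Real.rpow_le_rpow_of_exponent_le hB1 hexp
        _ ≤ ((D : ℝ) ^ 3 * (D : ℝ) ^ 3) ^ (1 / (16 * ell D)) :=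
            Real.rpow_le_rpow (by positivity) hB3 (by positivity)
        _ = Real.exp (6 / 16) := by
            rw [← pow_add, hDexp, ← Real.exp_nat_mul, ← Real.exp_mul]
            congr 1
            push_cast
            field_simp
        _ ≤ 3 := by
            have := Real.exp_one_lt_d9
            have h1 : Real.exp (6 / 16) ≤ Real.exp 1 := Real.exp_le_exp.mpr (by norm_num)
            linarith only [this, h1]
    have hlogpart : 4 + ell D + Real.log (‖s + beta1 c' D‖ + 1) ≤ 4 + 4 * ell D := by
      linarith only [hlog5]
    have h0 : 0 ≤ 4 + ell D + Real.log (‖s + beta1 c' D‖ + 1) := by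
      have : 0 ≤ Real.log (‖s + beta1 c' D‖ + 1) :=
        Real.log_nonneg (by linarith only [norm_nonneg (s + beta1 c' D)])
      linarith only [this, hℓ0]
    calc ((D : ℝ) * (‖s + beta1 c' D‖ + 1)) ^ (1 - s.re) * (4 + ell D + Real.log (‖s + beta1 c' D‖ + 1))
        ≤ 3 * (4 + 4 * ell D) := mul_le_mul hpow hlogpart h0 (by norm_num)
      _ ≤ 2 * ell D ^ 9 := by linarith only [hbig, hℓ1]


/-- `exp(2C(log(2𝓛) + 4) + 4C𝓛⁹/D²) ≤ (2𝓛)^{2C}·e^{12C}` for `𝓛⁹ ≤ D²` (`C = 4, 8` as natural powers).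
[folklore] -/
private theorem exp_weight_le {D : ℕ} (hℓ1 : 1 ≤ ell D) (hℓD : ell D ^ 9 ≤ (D : ℝ) ^ 2) (k : ℕ) :
    Real.exp (2 * (k : ℝ) * (Real.log (2 * Real.log D) + 4) + 4 * (k : ℝ) * Real.log D ^ 9 / (D : ℝ) ^ 2)
      ≤ (2 * ell D) ^ (2 * k) * Real.exp (12 * k) := by
  have hℓ0 : 0 < ell D := by linarith
  have hlD : Real.log (D : ℝ) = ell D := rfl
  rw [hlD]
  have hD2 : 0 < (D : ℝ) ^ 2 := lt_of_lt_of_le (by positivity) hℓD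
  have hratio : ell D ^ 9 / (D : ℝ) ^ 2 ≤ 1 := by
    rw [div_le_one hD2]; exact hℓD
  have hk0 : (0 : ℝ) ≤ k := Nat.cast_nonneg k
  have h1 : 2 * (k : ℝ) * (Real.log (2 * ell D) + 4) + 4 * (k : ℝ) * ell D ^ 9 / (D : ℝ) ^ 2 ≤
      (2 * k : ℕ) * Real.log (2 * ell D) + 12 * k := by
    have : 4 * (k : ℝ) * ell D ^ 9 / (D : ℝ) ^ 2 = 4 * k * (ell D ^ 9 / (D : ℝ) ^ 2) := by ring
    rw [this]
    push_cast
    nlinarith [hratio, hk0]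
  calc Real.exp (2 * (k : ℝ) * (Real.log (2 * ell D) + 4) + 4 * (k : ℝ) * ell D ^ 9 / (D : ℝ) ^ 2)
      ≤ Real.exp ((2 * k : ℕ) * Real.log (2 * ell D) + 12 * k) := Real.exp_le_exp.mpr h1
    _ = (2 * ell D) ^ (2 * k) * Real.exp (12 * k) := by
        rw [Real.exp_add, Real.exp_nat_mul, Real.exp_log (by positivity)]

/-- **Pointwise polynomial bound for `G = κ̃₂·λ₂·L(·+β₁,χ)` on the contour region**: for
`𝓛 ≥ max(8, 1 + 5|c′|)`, `𝓛⁹ ≤ D²`, `d₁, m ≥ 1` with `log d₁, log(d₁m) ≤ 𝓛⁹` (i.e. `d₁m ≤ P`), and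
`s` with `1 − 1/(16𝓛) ≤ σ ≤ 2`, `|t| ≤ D + 1 ∨ σ ≥ 1 + α`:
`‖κ̃₂(d₁;m,s)λ₂(d₁m,s)L(s+β₁,χ)‖ ≤ τ₂(d₁)·2²⁵e¹⁴⁴𝓛³³` — uniformly in `m` and `t`; the Euler-product
weights are absorbed by `Lemma84.prod_primeFactors_le` on `σ ≥ 1 − 1/(16𝓛)`.
[cite: Zhang2022LandauSiegel, §16 p.90 (u015)] -/
theorem norm_G_le (hχ : χ ≠ 1) (hℓ8 : 8 ≤ ell D) (hℓc : 1 + 5 * |c'| ≤ ell D)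
    (hℓD : ell D ^ 9 ≤ (D : ℝ) ^ 2) {d₁ m : ℕ} (hd₁ : d₁ ≠ 0) (hm : m ≠ 0)
    (hd₁P : Real.log d₁ ≤ ell D ^ 9) (hnP : Real.log ((d₁ * m : ℕ) : ℝ) ≤ ell D ^ 9)
    {s : ℂ} (hs1 : 1 - 1 / (16 * ell D) ≤ s.re) (hs2 : s.re ≤ 2)
    (hs3 : |s.im| ≤ (D : ℝ) + 1 ∨ 1 + alpha D ≤ s.re) :
    ‖kappaTilde2 c' χ d₁ m s * lam2 c' χ (d₁ * m) s * χ.LFunction (s + beta1 c' D)‖ ≤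
      (d₁.divisors.card : ℝ) * (2 ^ 25 * Real.exp 144 * ell D ^ 33) := by
  have hℓ1 : 1 ≤ ell D := by linarith only [hℓ8]
  have hℓ0 : 0 < ell D := by linarith only [hℓ8]
  have hlog2 : 2 ≤ Real.log (D : ℝ) := by show 2 ≤ ell D; linarith only [hℓ8]
  set σ₀ : ℝ := 1 - 1 / (16 * ell D) with hσ₀
  have h16 : 1 / (16 * ell D) ≤ 1 / 16 := by
    apply div_le_div_of_nonneg_left (by norm_num) (by norm_num); linarith only [hℓ1]
  have hσ₀half : 1 / 2 ≤ σ₀ := by rw [hσ₀]; linarith only [h16]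
  have hσ₀pos : 0 < σ₀ := by linarith only [hσ₀half]
  have hη0 : (0 : ℝ) ≤ 1 / (16 * ell D) := by positivity
  have hηL : 2 * (1 / (16 * ell D)) * Real.log D ≤ 1 / 4 := by
    show 2 * (1 / (16 * ell D)) * ell D ≤ 1 / 4
    field_simp; norm_num
  -- `κ̃₂`
  have hkap : ‖kappaTilde2 c' χ d₁ m s‖ ≤ (d₁.divisors.card : ℝ) * ((2 * ell D) ^ 8 * Real.exp 48) := by
    have h1 := norm_kappaTilde2_le_prod_inv c' χ hd₁ m hσ₀pos hs1
    have h2 := prod_inv_one_sub_le d₁ hσ₀half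
    have h3 := Lemma84.prod_primeFactors_le (D := D) (n := d₁) hlog2 hd₁ hd₁P (C := 4) (by norm_num)
      hη0 hηL (σ := σ₀) le_rfl
    have h4 := exp_weight_le hℓ1 hℓD 4
    have hω : (2 : ℝ) ^ d₁.primeFactors.card ≤ d₁.divisors.card := by
      exact_mod_cast two_pow_card_primeFactors_le_card_divisors' hd₁
    have hprod0 : 0 ≤ ∏ q ∈ d₁.primeFactors, (1 + 4 * (q : ℝ) ^ (-σ₀)) :=
      Finset.prod_nonneg fun q _ => by positivity
    calc ‖kappaTilde2 c' χ d₁ m s‖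
        ≤ 2 ^ d₁.primeFactors.card * ∏ q ∈ d₁.primeFactors, (1 - (q : ℝ) ^ (-σ₀))⁻¹ := h1
      _ ≤ (d₁.divisors.card : ℝ) * ∏ q ∈ d₁.primeFactors, (1 + 4 * (q : ℝ) ^ (-σ₀)) := by
          refine mul_le_mul hω h2 ?_ (by positivity)
          exact Finset.prod_nonneg fun q hq => inv_nonneg.mpr (by
            obtain ⟨h0, h1⟩ := prime_rpow_neg_le (Nat.prime_of_mem_primeFactors hq) hσ₀half
            linarith)
      _ ≤ (d₁.divisors.card : ℝ) * ((2 * ell D) ^ 8 * Real.exp 48) := by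
          apply mul_le_mul_of_nonneg_left _ (by positivity)
          refine h3.trans ?_
          have := h4
          norm_num at this ⊢
          exact this
  -- `λ₂`
  have hlam : ‖lam2 c' χ (d₁ * m) s‖ ≤ (2 * ell D) ^ 16 * Real.exp 96 := by
    have h1 := norm_lam2_le_prod_eight c' χ (d₁ * m) (le_trans hσ₀half hs1)
    have hmono : ∏ q ∈ (d₁ * m).primeFactors, (1 + 8 * (q : ℝ) ^ (-s.re)) ≤
        ∏ q ∈ (d₁ * m).primeFactors, (1 + 8 * (q : ℝ) ^ (-σ₀)) := by
      refine Finset.prod_le_prod (fun q hq => by positivity) fun q hq => ?_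
      have hq1 : (1 : ℝ) ≤ q := by exact_mod_cast (Nat.prime_of_mem_primeFactors hq).one_lt.le
      have : (q : ℝ) ^ (-s.re) ≤ (q : ℝ) ^ (-σ₀) :=
        Real.rpow_le_rpow_of_exponent_le hq1 (by linarith only [hs1])
      linarith only [this]
    have h3 := Lemma84.prod_primeFactors_le (D := D) (n := d₁ * m) hlog2 (mul_ne_zero hd₁ hm) hnP
      (C := 8) (by norm_num) hη0 hηL (σ := σ₀) le_rfl
    have h4 := exp_weight_le hℓ1 hℓD 8
    refine h1.trans (hmono.trans (h3.trans ?_))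
    have := h4
    norm_num at this ⊢
    exact this
  -- `L(s+β₁)`
  have hL := norm_LFunction_shift_le c' χ hχ hℓ8 hℓc hs1 hs2 hs3
  rw [norm_mul, norm_mul]
  have hτ0 : (0 : ℝ) ≤ d₁.divisors.card := Nat.cast_nonneg _
  calc ‖kappaTilde2 c' χ d₁ m s‖ * ‖lam2 c' χ (d₁ * m) s‖ * ‖χ.LFunction (s + beta1 c' D)‖
      ≤ (d₁.divisors.card : ℝ) * ((2 * ell D) ^ 8 * Real.exp 48) * ((2 * ell D) ^ 16 * Real.exp 96) *
          (2 * ell D ^ 9) := by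
        gcongr
    _ = (d₁.divisors.card : ℝ) * (2 ^ 25 * (Real.exp 48 * Real.exp 96) * ell D ^ 33) := by ring
    _ = (d₁.divisors.card : ℝ) * (2 ^ 25 * Real.exp 144 * ell D ^ 33) := by
        rw [← Real.exp_add]; norm_num

/-- **`G = κ̃₂·λ₂·L(·+β₁,χ)` is holomorphic on `σ > 9/10`** (`d₁ ≥ 1`, `χ ≠ χ₀`).
[cite: Zhang2022LandauSiegel, §16 p.90 (u015)] -/
theorem differentiableOn_G (hχ : χ ≠ 1) {d₁ : ℕ} (hd₁ : d₁ ≠ 0) (m : ℕ) :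
    DifferentiableOn ℂ (fun s => kappaTilde2 c' χ d₁ m s * lam2 c' χ (d₁ * m) s *
      χ.LFunction (s + beta1 c' D)) {s : ℂ | 9 / 10 < s.re} := by
  have h1 := differentiableOn_kappaTilde2_of_re c' χ hd₁ m
  have h3 : Differentiable ℂ fun s => χ.LFunction (s + beta1 c' D) :=
    (DirichletCharacter.differentiable_LFunction hχ).comp (differentiable_id.add_const _)
  intro s hs
  have hs0 : 0 < s.re := by have : 9 / 10 < s.re := hs; linarith
  exact ((h1 s hs).mul (differentiableAt_lam2 c' χ (d₁ * m) hs0).differentiableWithinAt).mul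
    (h3 s).differentiableWithinAt

end GBound

/-! ## §4. The parameters `y = Dpk/l₂` and `n = d₁d₂k` -/

section Params

/-- For `p ∼ P`, `d₁, d₂, k, l₂ ≥ 1` with `d₁d₂k < 2P₄ ≤ P` and `l₂T ≤ Dpk` (`𝓛 ≥ 8`):
`T ≤ y := Dpk/l₂`, `log y ≤ 3𝓛⁹`, `log d₁ ≤ 𝓛⁹`, `log(d₁d₂k) ≤ 𝓛⁹`.
[cite: Zhang2022LandauSiegel, §16 p.90 (u015: "Note that `Dpk/l₂ > T`")] -/
theorem params_u015 {D : ℕ} (hℓ8 : 8 ≤ ell D) (hP4 : 2 * P4 D ≤ bigP D) {p : ℕ}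
    (hp : p ∈ primeWindow D) {d₁ d₂ k l₂ : ℕ} (hd₁ : 1 ≤ d₁) (hd₂ : 1 ≤ d₂) (hk : 1 ≤ k)
    (hl₂ : 1 ≤ l₂) (hlT : (l₂ : ℝ) * bigT D ≤ (D : ℝ) * p * k)
    (hdk : ((d₁ * d₂ * k : ℕ) : ℝ) < 2 * P4 D) :
    bigT D ≤ (D : ℝ) * p * k / l₂ ∧ Real.log ((D : ℝ) * p * k / l₂) ≤ 3 * ell D ^ 9 ∧
      Real.log (d₁ : ℝ) ≤ ell D ^ 9 ∧ Real.log ((d₁ * (d₂ * k) : ℕ) : ℝ) ≤ ell D ^ 9 := by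
  have hℓ4 : 4 ≤ ell D := by linarith only [hℓ8]
  have hℓ1 : 1 ≤ ell D := by linarith only [hℓ8]
  have hℓ0 : 0 < ell D := by linarith only [hℓ8]
  obtain ⟨hD3r, -, -, -, -, -, -, hlogP, -⟩ := DeltaContourShift.param_facts hℓ4
  have hP0 : 0 < bigP D := bigP_pos D
  have hP1 : 1 ≤ bigP D := by rw [bigP]; exact Real.one_le_exp (by positivity)
  have hpP : bigP D < p := bigP_lt_of_mem_primeWindow hp
  have hp2P : (p : ℝ) ≤ 2 * bigP D := le_two_mul_bigP_of_mem_primeWindow hℓ1 hp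
  have hl₂R : (1 : ℝ) ≤ l₂ := by exact_mod_cast hl₂
  have hkR : (1 : ℝ) ≤ k := by exact_mod_cast hk
  have hd₁R : (1 : ℝ) ≤ d₁ := by exact_mod_cast hd₁
  have hd₂R : (1 : ℝ) ≤ d₂ := by exact_mod_cast hd₂
  have hnR : ((d₁ * d₂ * k : ℕ) : ℝ) = (d₁ : ℝ) * d₂ * k := by push_cast; ring
  have hnP : (d₁ : ℝ) * d₂ * k < bigP D := by rw [← hnR]; linarith only [hdk, hP4]
  have hp0 : (0 : ℝ) < p := pos_of_mem_primeWindow hp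
  have hkn : (k : ℝ) ≤ (d₁ : ℝ) * d₂ * k := by
    calc (k : ℝ) = 1 * 1 * k := by ring
      _ ≤ (d₁ : ℝ) * d₂ * k := by gcongr
  have hd₁n : (d₁ : ℝ) ≤ (d₁ : ℝ) * d₂ * k := by
    calc (d₁ : ℝ) = d₁ * 1 * 1 := by ring
      _ ≤ (d₁ : ℝ) * d₂ * k := by gcongr
  have hbig : 100 * ell D ≤ ell D ^ 9 := by
    have h8 : (8 : ℝ) ^ 8 ≤ ell D ^ 8 := pow_le_pow_left₀ (by norm_num) hℓ8 8
    have h100 : (100 : ℝ) ≤ ell D ^ 8 := le_trans (by norm_num) h8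
    calc 100 * ell D ≤ ell D ^ 8 * ell D := mul_le_mul_of_nonneg_right h100 hℓ0.le
      _ = ell D ^ 9 := by ring
  refine ⟨?_, ?_, ?_, ?_⟩
  · rw [le_div_iff₀ (by positivity)]
    linarith only [hlT]
  · have hy : (D : ℝ) * p * k / l₂ ≤ (D : ℝ) * (2 * bigP D) * bigP D := by
      rw [div_le_iff₀ (by positivity)]
      have h1 : (D : ℝ) * p * k ≤ (D : ℝ) * (2 * bigP D) * bigP D := by
        have : (k : ℝ) ≤ bigP D := by linarith only [hkn, hnP]
        gcongr
      calc (D : ℝ) * p * k ≤ (D : ℝ) * (2 * bigP D) * bigP D := h1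
        _ = (D : ℝ) * (2 * bigP D) * bigP D * 1 := by ring
        _ ≤ (D : ℝ) * (2 * bigP D) * bigP D * l₂ := by gcongr
    have hypos : 0 < (D : ℝ) * p * k / l₂ := by positivity
    calc Real.log ((D : ℝ) * p * k / l₂) ≤ Real.log ((D : ℝ) * (2 * bigP D) * bigP D) :=
          Real.log_le_log hypos hy
      _ = ell D + Real.log 2 + 2 * ell D ^ 9 := by
          rw [Real.log_mul (by positivity) hP0.ne', Real.log_mul (by positivity) (by positivity),
            Real.log_mul (by norm_num) hP0.ne', hlogP, ell]
          ring
      _ ≤ 3 * ell D ^ 9 := by linarith only [hbig, hℓ1, Real.log_two_lt_d9]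
  · calc Real.log (d₁ : ℝ) ≤ Real.log (bigP D) := Real.log_le_log (by positivity) (by linarith only [hd₁n, hnP])
      _ = ell D ^ 9 := hlogP
  · have : ((d₁ * (d₂ * k) : ℕ) : ℝ) = (d₁ : ℝ) * d₂ * k := by push_cast; ring
    rw [this]
    calc Real.log ((d₁ : ℝ) * d₂ * k) ≤ Real.log (bigP D) := Real.log_le_log (by positivity) hnP.le
      _ = ell D ^ 9 := hlogP

end Params

/-! ## §5. The node: master form, as printed, and on the support of `b₁` -/

section Main

set_option maxHeartbeats 800000 in -- long instantiation of the engine (G, M, y) plus bookkeeping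
/-- **u015, master form (all `l₂` with `l₂T ≤ Dpk`).** For every `c′` there is `C` such that for all
large `D`, every real primitive `χ (mod D)` with (A), `p ∼ P`, `d₁, d₂, k, l₂ ≥ 1` with `d₁d₂k < 2P₄` and
`l₂T ≤ Dpk`:
`‖Σ_{(l₁,d₂k)=1} κ₂(d₁l₁)χ(l₁)Δ(l₁l₂/(Dpk)) − ℛ₂*·(Dpk/l₂)·κ̃₂(d₁;d₂k)λ₂(d₁d₂k)‖ ≤ C·τ₂(d₁)·𝓛⁻¹⁹⁰⁰·Dpk/l₂`
— (16.4) (`eq16_4_holds`) + u012 (`step16_u012_holds`) + the engine `DeltaContourShift.deltaContourShift`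
with `G = κ̃₂λ₂L(·+β₁,χ)`, `M = τ₂(d₁)2²⁵e¹⁴⁴𝓛³³`. [cite: Zhang2022LandauSiegel, §16 p.90 (u015)] -/
theorem step16_u015_master (c' : ℝ) : ∃ C : ℝ, 0 ≤ C ∧ ForAllLarge fun D _ χ => AssumptionA D χ →
    ∀ p ∈ primeWindow D, ∀ d₁ d₂ k l₂ : ℕ, 1 ≤ d₁ → 1 ≤ d₂ → 1 ≤ k → 1 ≤ l₂ →
      (l₂ : ℝ) * bigT D ≤ (D : ℝ) * p * k → ((d₁ * d₂ * k : ℕ) : ℝ) < 2 * P4 D →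
      ‖(∑' l₁ : ℕ, if Nat.Coprime l₁ (d₂ * k) then
            kappa2 c' D (d₁ * l₁) * χ (l₁ : ZMod D) *
              DeltaW D (((l₁ * l₂ : ℕ) : ℝ) / ((D : ℝ) * p * k))
          else 0) -
          calR2star c' χ * (((D : ℝ) * p * k / l₂ : ℝ) : ℂ) * kappaTilde2 c' χ d₁ (d₂ * k) 1 *
            lam2 c' χ (d₁ * d₂ * k) 1‖ ≤
        C * (d₁.divisors.card : ℝ) * (ell D ^ 1900)⁻¹ * ((D : ℝ) * p * k / l₂) := by
  obtain ⟨C, hC0, D₀, hE⟩ := DeltaContourShift.deltaContourShift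
  obtain ⟨D₁, h164⟩ := eq16_4_holds c'
  obtain ⟨D₂, hP4⟩ := Typed.Sec14.exists_two_mul_P4_le_bigP
  obtain ⟨D₃, hℓ9D⟩ := exists_mul_ell_pow_le 9 (zero_le_one)
  obtain ⟨D₄, hD₄⟩ := exists_forall_le_ell (8 + 5 * |c'|)
  refine ⟨C * (2 ^ 25 * Real.exp 144), by positivity, max (max D₀ D₁) (max (max D₂ D₃) D₄),
    fun D _ χ hD hq hprim hA p hp d₁ d₂ k l₂ hd₁ hd₂ hk hl₂ hlT hdk => ?_⟩
  have hD₀ : D₀ ≤ D := le_trans (le_trans (le_max_left _ _) (le_max_left _ _)) hD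
  have hD₁ : D₁ ≤ D := le_trans (le_trans (le_max_right _ _) (le_max_left _ _)) hD
  have hD₂ : D₂ ≤ D := le_trans (le_trans (le_trans (le_max_left _ _) (le_max_left _ _)) (le_max_right _ _)) hD
  have hD₃ : D₃ ≤ D := le_trans (le_trans (le_trans (le_max_right _ _) (le_max_left _ _)) (le_max_right _ _)) hD
  have hD₄' : D₄ ≤ D := le_trans (le_trans (le_max_right _ _) (le_max_right _ _)) hD
  have hL := hD₄ D hD₄'
  have habs : 0 ≤ 5 * |c'| := by positivity
  have hℓ8 : 8 ≤ ell D := by linarith only [hL, habs]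
  have hℓc : 1 + 5 * |c'| ≤ ell D := by linarith only [hL, habs]
  have hℓ4 : 4 ≤ ell D := by linarith only [hℓ8]
  have hℓ1 : 1 ≤ ell D := by linarith only [hℓ8]
  obtain ⟨hD3r, hD3, -⟩ := DeltaContourShift.param_facts hℓ4
  have hℓD : ell D ^ 9 ≤ (D : ℝ) ^ 2 := by
    have h1 : 1 * ell D ^ 9 ≤ D := hℓ9D D hD₃
    have h2 : (D : ℝ) ≤ (D : ℝ) ^ 2 := by nlinarith only [hD3r]
    linarith only [h1, h2]
  have hχ1 : χ ≠ 1 := ne_one_of_isPrimitive_of_three_le hprim hD3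
  obtain ⟨hTy, hlogy, hd₁P, hnP⟩ := params_u015 hℓ8 (hP4 D hD₂) hp hd₁ hd₂ hk hl₂ hlT hdk
  have hd₁0 : d₁ ≠ 0 := by omega
  have hm0 : d₂ * k ≠ 0 := Nat.mul_ne_zero (by omega) (by omega)
  have hm1 : 1 ≤ d₂ * k := Nat.one_le_iff_ne_zero.mpr hm0
  have hp0 : (0 : ℝ) < p := pos_of_mem_primeWindow hp
  have hy0 : 0 < (D : ℝ) * p * k / l₂ := by
    have : (0 : ℝ) < k := by exact_mod_cast hk
    have : (0 : ℝ) < l₂ := by exact_mod_cast hl₂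
    positivity
  -- the factor `G` and its bound `M`
  set y : ℝ := (D : ℝ) * p * k / l₂ with hy
  set G : ℂ → ℂ := fun s => kappaTilde2 c' χ d₁ (d₂ * k) s * lam2 c' χ (d₁ * (d₂ * k)) s *
    χ.LFunction (s + beta1 c' D) with hG
  set M : ℝ := (d₁.divisors.card : ℝ) * (2 ^ 25 * Real.exp 144 * ell D ^ 33) with hM
  have hM0 : 0 ≤ M := by positivity
  have hGdiff : DifferentiableOn ℂ G {s : ℂ | 9 / 10 < s.re} := differentiableOn_G c' χ hχ1 hd₁0 (d₂ * k)
  have hGM : ∀ s : ℂ, 1 - 1 / (16 * ell D) ≤ s.re → s.re ≤ 2 →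
      (|s.im| ≤ (D : ℝ) + 1 ∨ 1 + alpha D ≤ s.re) → ‖G s‖ ≤ M := fun s h1 h2 h3 =>
    norm_G_le c' χ hχ1 hℓ8 hℓc hℓD hd₁0 hm0 hd₁P hnP h1 h2 h3
  have hEng := hE D χ hD₀ hq hprim hA G M hM0 hGdiff hGM y hTy hlogy
  -- (16.4) and u012: the left side is the engine's line integral
  have hEq := h164 D χ hD₁ hq hprim p hp d₁ d₂ k l₂ hd₁ hd₂ hk hl₂
  have hint : ∀ t : ℝ, integrand16_4 c' χ d₁ (d₂ * k) y (2 + t * I) =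
      G (2 + t * I) * (χ.LFunction (2 + t * I))⁻¹ * (y : ℂ) ^ (2 + t * I : ℂ) * deltaW D (2 + t * I) := by
    intro t
    have h12 := Typed.Section16ALeaves.step16_u012_holds c' D χ hq hprim d₁ (d₂ * k) hd₁ hm1
      (2 + t * I) (by simp)
    rw [integrand16_4, h12, hG]
    simp only [div_eq_mul_inv]
    ring
  have hfun : (fun t : ℝ => integrand16_4 c' χ d₁ (d₂ * k) y (2 + t * I)) =
      fun t : ℝ => G (2 + t * I) * (χ.LFunction (2 + t * I))⁻¹ * (y : ℂ) ^ (2 + t * I : ℂ) *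
        deltaW D (2 + t * I) := funext hint
  rw [hEq, hfun]
  -- the main term
  have hmain : calR2star c' χ * ((y : ℝ) : ℂ) * kappaTilde2 c' χ d₁ (d₂ * k) 1 *
      lam2 c' χ (d₁ * d₂ * k) 1 = G 1 * (y : ℂ) * deltaW D 1 / deriv χ.LFunction 1 := by
    rw [hG, calR2star, Nat.mul_assoc]
    simp only []
    ring
  rw [hmain]
  refine hEng.trans ?_
  -- `C·M·y·𝓛⁻²⁰⁰⁰ ≤ C·2²⁵e¹⁴⁴·τ₂(d₁)·𝓛⁻¹⁹⁰⁰·y`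
  rw [hM]
  have hpow : ell D ^ 33 * (ell D ^ 2000)⁻¹ ≤ (ell D ^ 1900)⁻¹ := by
    have h2000 : 0 < ell D ^ 2000 := by positivity
    have h1900 : 0 < ell D ^ 1900 := by positivity
    rw [← div_eq_mul_inv, div_le_iff₀ h2000, ← div_eq_inv_mul, le_div_iff₀ h1900, ← pow_add]
    exact pow_le_pow_right₀ hℓ1 (by norm_num)
  have hτ0 : (0 : ℝ) ≤ d₁.divisors.card := Nat.cast_nonneg _
  calc C * ((d₁.divisors.card : ℝ) * (2 ^ 25 * Real.exp 144 * ell D ^ 33)) * y * (ell D ^ 2000)⁻¹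
      = C * (2 ^ 25 * Real.exp 144) * (d₁.divisors.card : ℝ) * (ell D ^ 33 * (ell D ^ 2000)⁻¹) * y := by
        ring
    _ ≤ C * (2 ^ 25 * Real.exp 144) * (d₁.divisors.card : ℝ) * (ell D ^ 1900)⁻¹ * y := by
        gcongr

/-- `(ℓ^1900)⁻¹ ≤ α¹⁰⁰ = π¹⁰⁰/ℓ⁹⁰⁰` for `ℓ ≥ 1` (`α = π/ℓ⁹`). [cite: Zhang2022LandauSiegel, §2 (2.10)] -/
private theorem inv_pow_le_alpha_pow {D : ℕ} (hℓ4 : 4 ≤ ell D) :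
    (ell D ^ 1900)⁻¹ ≤ alpha D ^ 100 := by
  have hℓ1 : 1 ≤ ell D := by linarith only [hℓ4]
  obtain ⟨-, -, -, -, -, -, -, -, hαval⟩ := DeltaContourShift.param_facts hℓ4
  rw [hαval, div_pow]
  have h900 : 0 < ell D ^ 900 := by positivity
  have hπ : (1 : ℝ) ≤ π ^ 100 := one_le_pow₀ (by linarith only [Real.pi_gt_three])
  have hpow : (ell D ^ 9) ^ 100 = ell D ^ 900 := by rw [← pow_mul]
  rw [hpow]
  calc (ell D ^ 1900)⁻¹ ≤ (ell D ^ 900)⁻¹ :=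
        inv_anti₀ h900 (pow_le_pow_right₀ hℓ1 (by norm_num))
    _ = 1 / ell D ^ 900 := (one_div _).symm
    _ ≤ π ^ 100 / ell D ^ 900 := div_le_div_of_nonneg_right hπ h900.le

/-- **`Z22:§16.u015` HOLDS AS PRINTED** (`Typed.Section16A.Step16_u015 c'`, every `c′`): for `l₂ < P₂²`
(= `P/T²⁰`, so `l₂T ≤ P < p ≤ Dpk`) the master form applies and `𝓛⁻¹⁹⁰⁰ ≤ α¹⁰⁰`. CONDITIONAL on (A)
as every §§5–18 statement of the source; kernel theorem about the typed-as-printed display only.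
[cite: Zhang2022LandauSiegel, §16 p.90 (u015)] -/
theorem step16_u015_holds (c' : ℝ) : Step16_u015 c' := by
  obtain ⟨C, hC0, D₀, hm⟩ := step16_u015_master c'
  obtain ⟨D₄, hD₄⟩ := exists_forall_le_ell (8 : ℝ)
  refine ⟨C, max D₀ D₄, fun D _ χ hD hq hprim hA p hp d₁ d₂ k l₂ hd₁ hd₂ hk hl₂ hl₂P hdk => ?_⟩
  have hD₀ : D₀ ≤ D := le_trans (le_max_left _ _) hD
  have hℓ8 : 8 ≤ ell D := hD₄ D (le_trans (le_max_right _ _) hD)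
  have hℓ4 : 4 ≤ ell D := by linarith only [hℓ8]
  have hℓ1 : 1 ≤ ell D := by linarith only [hℓ8]
  obtain ⟨hD3r, -⟩ := DeltaContourShift.param_facts hℓ4
  have hP0 : 0 < bigP D := bigP_pos D
  have hT1 : 1 ≤ bigT D := by rw [bigT]; exact Real.one_le_exp (by positivity)
  have hpP : bigP D < p := bigP_lt_of_mem_primeWindow hp
  have hkR : (1 : ℝ) ≤ k := by exact_mod_cast hk
  have hl₂0 : (0 : ℝ) ≤ l₂ := Nat.cast_nonneg _
  -- `l₂ T ≤ Dpk`
  have hsq : Skeleton.P2 D ^ 2 = bigP D / bigT D ^ 20 := by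
    have h1 : (bigP D ^ (0.5 : ℝ)) ^ 2 = bigP D := by
      rw [← Real.rpow_natCast (bigP D ^ (0.5 : ℝ)) 2, ← Real.rpow_mul hP0.le]; norm_num
    rw [Skeleton.P2, div_pow, h1, ← pow_mul]
  have hlT : (l₂ : ℝ) * bigT D ≤ (D : ℝ) * p * k := by
    rw [hsq] at hl₂P
    have hT20 : 0 < bigT D ^ 20 := by positivity
    have h1 : (l₂ : ℝ) * bigT D ≤ bigP D / bigT D ^ 20 * bigT D :=
      mul_le_mul_of_nonneg_right hl₂P.le (by linarith only [hT1])
    have h2 : bigP D / bigT D ^ 20 * bigT D ≤ bigP D := by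
      rw [div_mul_eq_mul_div, div_le_iff₀ hT20]
      have : bigT D ≤ bigT D ^ 20 := le_self_pow₀ hT1 (by norm_num)
      nlinarith only [this, hP0]
    have h3 : bigP D ≤ (D : ℝ) * p * k := by
      calc bigP D ≤ 1 * (p : ℝ) * 1 := by linarith only [hpP]
        _ ≤ (D : ℝ) * p * k := by gcongr; linarith only [hD3r]
    linarith only [h1, h2, h3]
  have h := hm D χ hD₀ hq hprim hA p hp d₁ d₂ k l₂ hd₁ hd₂ hk hl₂ hlT hdk
  refine h.trans ?_
  have hy0 : 0 ≤ (D : ℝ) * p * k / l₂ := by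
    have hp0 : (0 : ℝ) < p := pos_of_mem_primeWindow hp
    positivity
  have hτ0 : (0 : ℝ) ≤ d₁.divisors.card := Nat.cast_nonneg _
  calc C * (d₁.divisors.card : ℝ) * (ell D ^ 1900)⁻¹ * ((D : ℝ) * p * k / l₂)
      ≤ C * (d₁.divisors.card : ℝ) * alpha D ^ 100 * ((D : ℝ) * p * k / l₂) := by
        gcongr
        exact inv_pow_le_alpha_pow hℓ4
    _ = C * alpha D ^ 100 * (d₁.divisors.card : ℝ) * ((D : ℝ) * p * k / l₂) := by ring

variable (c' : ℝ) in
/-- `Step16_u015` — `_holds` alias of `step16_u015_holds` above under the fact's exact name, stated under the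
prover's own binders as section variables (appended 2026-08-28, D-0026 bookkeeping: the proof term is the
existing theorem of this file; no statement, definition or attribute is edited; no new named fact; the
ledger's debt table listed the fact unproved). [cite: Zhang2022LandauSiegel, §16 p.90 (u015)] -/
theorem _root_.Literature.NumberTheory.LFunctions.Zhang2022.Typed.Section16A.Step16_u015_holds :
    _root_.Literature.NumberTheory.LFunctions.Zhang2022.Typed.Section16A.Step16_u015 c' :=
  _root_.Literature.NumberTheory.LFunctions.Zhang2022.Typed.Section16A.step16_u015_holds (c' := c')

/-- `2T³P^{1/2}·max(P₂,P₃) ≤ P` for `𝓛 ≥ 8` (`P₂ = P^{1/2}T^{−10}`, `P₃ = P^{0.498}`; `2 ≤ T⁷` and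
`2T³ ≤ P^{0.002}`, i.e. `1 + 3𝓛^{1.1} ≤ 0.002𝓛⁹`). [cite: Zhang2022LandauSiegel, §2 (2.21)–(2.23)] -/
private theorem support_range_le {D : ℕ} (hℓ8 : 8 ≤ ell D) :
    2 * bigT D ^ 2 * (bigP D ^ (1 / 2 : ℝ) * max (Skeleton.P2 D) (P3 D)) * bigT D ≤ bigP D := by
  have hℓ1 : 1 ≤ ell D := by linarith only [hℓ8]
  have hℓ0 : 0 < ell D := by linarith only [hℓ8]
  have hP0 : 0 < bigP D := bigP_pos D
  have hT0 : 0 < bigT D := Real.exp_pos _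
  have hT1 : 1 ≤ bigT D := by rw [bigT]; exact Real.one_le_exp (by positivity)
  -- `T ≥ 2`
  have hT2 : 2 ≤ bigT D := by
    rw [bigT]
    have h1 : (1 : ℝ) ≤ ell D ^ (1.1 : ℝ) := Real.one_le_rpow hℓ1 (by norm_num)
    have h2 := Real.add_one_le_exp (ell D ^ (1.1 : ℝ))
    linarith only [h1, h2]
  -- `2T³ ≤ P^{0.002}`
  have h11 : ell D ^ (1.1 : ℝ) ≤ ell D ^ 2 := by
    calc ell D ^ (1.1 : ℝ) ≤ ell D ^ (2 : ℝ) := Real.rpow_le_rpow_of_exponent_le hℓ1 (by norm_num)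
      _ = ell D ^ 2 := by norm_num
  have h7 : (8 : ℝ) ^ 7 ≤ ell D ^ 7 := pow_le_pow_left₀ (by norm_num) hℓ8 7
  have hbig : 1 + 3 * ell D ^ 2 ≤ 0.002 * ell D ^ 9 := by
    have h2 : 1 ≤ ell D ^ 2 := one_le_pow₀ hℓ1
    have h9 : ell D ^ 9 = ell D ^ 7 * ell D ^ 2 := by ring
    rw [h9]
    nlinarith only [h7, h2]
  have hexp : 2 * bigT D ^ 3 ≤ bigP D ^ (0.002 : ℝ) := by
    have hT3 : bigT D ^ 3 = Real.exp (3 * ell D ^ (1.1 : ℝ)) := by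
      rw [bigT, ← Real.exp_nat_mul]; norm_num
    have hP2 : bigP D ^ (0.002 : ℝ) = Real.exp (0.002 * ell D ^ 9) := by
      rw [bigP, ← Real.exp_mul, mul_comm]
    have h2 : (2 : ℝ) ≤ Real.exp 1 := by
      have := Real.add_one_le_exp (1 : ℝ); linarith only [this]
    rw [hT3, hP2]
    calc 2 * Real.exp (3 * ell D ^ (1.1 : ℝ)) ≤ Real.exp 1 * Real.exp (3 * ell D ^ (1.1 : ℝ)) :=
          mul_le_mul_of_nonneg_right h2 (Real.exp_pos _).le
      _ = Real.exp (1 + 3 * ell D ^ (1.1 : ℝ)) := by rw [← Real.exp_add]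
      _ ≤ Real.exp (0.002 * ell D ^ 9) := Real.exp_le_exp.mpr (by nlinarith only [h11, hbig])
  -- the two pieces of the `max`
  have hhalf : bigP D ^ (1 / 2 : ℝ) * Skeleton.P2 D = bigP D / bigT D ^ 10 := by
    rw [Skeleton.P2, mul_div_assoc', ← Real.rpow_add hP0]; norm_num
  have h998 : bigP D ^ (1 / 2 : ℝ) * P3 D = bigP D ^ (0.998 : ℝ) := by
    rw [P3, ← Real.rpow_add hP0]; norm_num
  have hsplitP : bigP D = bigP D ^ (0.998 : ℝ) * bigP D ^ (0.002 : ℝ) := by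
    rw [← Real.rpow_add hP0]; norm_num
  rw [mul_max_of_nonneg _ _ (Real.rpow_nonneg hP0.le _), hhalf, h998]
  rcases le_total (bigP D / bigT D ^ 10) (bigP D ^ (0.998 : ℝ)) with hle | hle
  · rw [max_eq_right hle]
    calc 2 * bigT D ^ 2 * bigP D ^ (0.998 : ℝ) * bigT D = bigP D ^ (0.998 : ℝ) * (2 * bigT D ^ 3) := by
          ring
      _ ≤ bigP D ^ (0.998 : ℝ) * bigP D ^ (0.002 : ℝ) :=
          mul_le_mul_of_nonneg_left hexp (Real.rpow_nonneg hP0.le _)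
      _ = bigP D := hsplitP.symm
  · rw [max_eq_left hle]
    have hT10 : 0 < bigT D ^ 10 := by positivity
    have hT7 : 2 ≤ bigT D ^ 7 := le_trans hT2 (le_self_pow₀ hT1 (by norm_num))
    calc 2 * bigT D ^ 2 * (bigP D / bigT D ^ 10) * bigT D = bigP D * (2 * bigT D ^ 3 / bigT D ^ 10) := by
          ring
      _ ≤ bigP D * 1 := by
          apply mul_le_mul_of_nonneg_left _ hP0.le
          rw [div_le_one hT10]
          calc 2 * bigT D ^ 3 ≤ bigT D ^ 7 * bigT D ^ 3 := mul_le_mul_of_nonneg_right hT7 (by positivity)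
            _ = bigT D ^ 10 := by ring
      _ = bigP D := mul_one _

/-- **u015 on the whole support of `b₁`, in the weighted/polynomial shape consumed by
`step16_u018w_of_u015ww`** (`l₂ < 2T²P^{1/2}max(P₂,P₃)`, weight exponent `c₀ = 0`, rate `𝓛⁻²⁰⁰`):
from the master form, since `l₂T ≤ P < Dpk` on that range and `𝓛⁻¹⁹⁰⁰ ≤ 𝓛⁻²⁰⁰`.
[cite: Zhang2022LandauSiegel, §16 p.90 (u015)] -/
theorem step16_u015ww_holds (c' : ℝ) : ∃ c₀ C : ℝ, ForAllLarge fun D _ χ => AssumptionA D χ →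
    ∀ p ∈ primeWindow D, ∀ d₁ d₂ k l₂ : ℕ, 1 ≤ d₁ → 1 ≤ d₂ → 1 ≤ k → 1 ≤ l₂ →
      (l₂ : ℝ) < 2 * bigT D ^ 2 * (bigP D ^ (1 / 2 : ℝ) * max (Skeleton.P2 D) (P3 D)) →
      ((d₁ * d₂ * k : ℕ) : ℝ) < 2 * P4 D →
      ‖(∑' l₁ : ℕ, if Nat.Coprime l₁ (d₂ * k) then
            kappa2 c' D (d₁ * l₁) * χ (l₁ : ZMod D) *
              DeltaW D (((l₁ * l₂ : ℕ) : ℝ) / ((D : ℝ) * p * k))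
          else 0) -
          calR2star c' χ * (((D : ℝ) * p * k / l₂ : ℝ) : ℂ) * kappaTilde2 c' χ d₁ (d₂ * k) 1 *
            lam2 c' χ (d₁ * d₂ * k) 1‖ ≤
        C * (d₁.divisors.card : ℝ) *
          (∏ q ∈ (d₁ * d₂ * k).primeFactors, (1 + c₀ / (q : ℝ) ^ (9 / 10 : ℝ))) *
          (ell D ^ 200)⁻¹ * ((D : ℝ) * p * k / l₂) := by
  obtain ⟨C, hC0, D₀, hm⟩ := step16_u015_master c'
  obtain ⟨D₄, hD₄⟩ := exists_forall_le_ell (8 : ℝ)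
  refine ⟨0, C, max D₀ D₄, fun D _ χ hD hq hprim hA p hp d₁ d₂ k l₂ hd₁ hd₂ hk hl₂ hl₂S hdk => ?_⟩
  have hD₀ : D₀ ≤ D := le_trans (le_max_left _ _) hD
  have hℓ8 : 8 ≤ ell D := hD₄ D (le_trans (le_max_right _ _) hD)
  have hℓ4 : 4 ≤ ell D := by linarith only [hℓ8]
  have hℓ1 : 1 ≤ ell D := by linarith only [hℓ8]
  obtain ⟨hD3r, -⟩ := DeltaContourShift.param_facts hℓ4
  have hT0 : 0 < bigT D := Real.exp_pos _
  have hpP : bigP D < p := bigP_lt_of_mem_primeWindow hp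
  -- `l₂ T ≤ Dpk`
  have hlT : (l₂ : ℝ) * bigT D ≤ (D : ℝ) * p * k := by
    have h1 : (l₂ : ℝ) * bigT D ≤ 2 * bigT D ^ 2 * (bigP D ^ (1 / 2 : ℝ) * max (Skeleton.P2 D) (P3 D)) *
        bigT D := mul_le_mul_of_nonneg_right hl₂S.le hT0.le
    have h2 := support_range_le hℓ8
    have h3 : bigP D ≤ (D : ℝ) * p * k := by
      have hkR : (1 : ℝ) ≤ k := by exact_mod_cast hk
      calc bigP D ≤ 1 * (p : ℝ) * 1 := by linarith only [hpP]
        _ ≤ (D : ℝ) * p * k := by gcongr; linarith only [hD3r]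
    linarith only [h1, h2, h3]
  have h := hm D χ hD₀ hq hprim hA p hp d₁ d₂ k l₂ hd₁ hd₂ hk hl₂ hlT hdk
  refine h.trans ?_
  have hprod : ∏ q ∈ (d₁ * d₂ * k).primeFactors, (1 + (0 : ℝ) / (q : ℝ) ^ (9 / 10 : ℝ)) = 1 :=
    Finset.prod_eq_one fun q _ => by rw [zero_div, add_zero]
  rw [hprod, mul_one]
  have hy0 : 0 ≤ (D : ℝ) * p * k / l₂ := by
    have hp0 : (0 : ℝ) < p := pos_of_mem_primeWindow hp
    positivity
  have hpow : (ell D ^ 1900)⁻¹ ≤ (ell D ^ 200)⁻¹ :=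
    inv_anti₀ (by positivity) (pow_le_pow_right₀ hℓ1 (by norm_num))
  gcongr

/-- **u015 with the printed rate `α¹⁰⁰τ₂(d₁)` on the whole support of `b₁`** (`l₂ < 2T²P^{1/2}max(P₂,P₃)`)
— the hypothesis shape of the tree's edge `step16_u018_of_u015w`; from the master form as above.
[cite: Zhang2022LandauSiegel, §16 p.90 (u015)] -/
theorem step16_u015w_holds (c' : ℝ) : ∃ C : ℝ, ForAllLarge fun D _ χ => AssumptionA D χ →
    ∀ p ∈ primeWindow D, ∀ d₁ d₂ k l₂ : ℕ, 1 ≤ d₁ → 1 ≤ d₂ → 1 ≤ k → 1 ≤ l₂ →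
      (l₂ : ℝ) < 2 * bigT D ^ 2 * (bigP D ^ (1 / 2 : ℝ) * max (Skeleton.P2 D) (P3 D)) →
      ((d₁ * d₂ * k : ℕ) : ℝ) < 2 * P4 D →
      ‖(∑' l₁ : ℕ, if Nat.Coprime l₁ (d₂ * k) then
            kappa2 c' D (d₁ * l₁) * χ (l₁ : ZMod D) *
              DeltaW D (((l₁ * l₂ : ℕ) : ℝ) / ((D : ℝ) * p * k))
          else 0) -
          calR2star c' χ * (((D : ℝ) * p * k / l₂ : ℝ) : ℂ) * kappaTilde2 c' χ d₁ (d₂ * k) 1 *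
            lam2 c' χ (d₁ * d₂ * k) 1‖ ≤
        C * alpha D ^ 100 * d₁.divisors.card * ((D : ℝ) * p * k / l₂) := by
  obtain ⟨C, hC0, D₀, hm⟩ := step16_u015_master c'
  obtain ⟨D₄, hD₄⟩ := exists_forall_le_ell (8 : ℝ)
  refine ⟨C, max D₀ D₄, fun D _ χ hD hq hprim hA p hp d₁ d₂ k l₂ hd₁ hd₂ hk hl₂ hl₂S hdk => ?_⟩
  have hD₀ : D₀ ≤ D := le_trans (le_max_left _ _) hD
  have hℓ8 : 8 ≤ ell D := hD₄ D (le_trans (le_max_right _ _) hD)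
  have hℓ4 : 4 ≤ ell D := by linarith only [hℓ8]
  have hℓ1 : 1 ≤ ell D := by linarith only [hℓ8]
  obtain ⟨hD3r, -⟩ := DeltaContourShift.param_facts hℓ4
  have hT0 : 0 < bigT D := Real.exp_pos _
  have hpP : bigP D < p := bigP_lt_of_mem_primeWindow hp
  have hlT : (l₂ : ℝ) * bigT D ≤ (D : ℝ) * p * k := by
    have h1 : (l₂ : ℝ) * bigT D ≤ 2 * bigT D ^ 2 * (bigP D ^ (1 / 2 : ℝ) * max (Skeleton.P2 D) (P3 D)) *
        bigT D := mul_le_mul_of_nonneg_right hl₂S.le hT0.le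
    have h2 := support_range_le hℓ8
    have h3 : bigP D ≤ (D : ℝ) * p * k := by
      have hkR : (1 : ℝ) ≤ k := by exact_mod_cast hk
      calc bigP D ≤ 1 * (p : ℝ) * 1 := by linarith only [hpP]
        _ ≤ (D : ℝ) * p * k := by gcongr; linarith only [hD3r]
    linarith only [h1, h2, h3]
  have h := hm D χ hD₀ hq hprim hA p hp d₁ d₂ k l₂ hd₁ hd₂ hk hl₂ hlT hdk
  refine h.trans ?_
  have hy0 : 0 ≤ (D : ℝ) * p * k / l₂ := by
    have hp0 : (0 : ℝ) < p := pos_of_mem_primeWindow hp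
    positivity
  have hτ0 : (0 : ℝ) ≤ d₁.divisors.card := Nat.cast_nonneg _
  calc C * (d₁.divisors.card : ℝ) * (ell D ^ 1900)⁻¹ * ((D : ℝ) * p * k / l₂)
      ≤ C * (d₁.divisors.card : ℝ) * alpha D ^ 100 * ((D : ℝ) * p * k / l₂) := by
        gcongr
        exact inv_pow_le_alpha_pow hℓ4
    _ = C * alpha D ^ 100 * (d₁.divisors.card : ℝ) * ((D : ℝ) * p * k / l₂) := by ring


/-- **`Z22:§16.u018` HOLDS** (`Typed.Section16A.Step16_u018 c'`, every `c′`): the tree's edge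
`step16_u018_of_u015w` (zl-w16-p1, `Section16AU018OfU015`: u015 on the support of `b₁` ⇒ u018) fed
with `step16_u015w_holds`. CONDITIONAL on (A) as the manuscript.
[cite: Zhang2022LandauSiegel, §16 p.90 (u018)] -/
theorem step16_u018_holds (c' : ℝ) : Step16_u018 c' := step16_u018_of_u015w c' (step16_u015w_holds c')

variable (c' : ℝ) in
/-- `Step16_u018` — `_holds` alias of `step16_u018_holds` above under the fact's exact name, stated under the
prover's own binders as section variables (appended 2026-08-28, D-0026 bookkeeping: the proof term is the
existing theorem of this file; no statement, definition or attribute is edited; no new named fact; the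
ledger's debt table listed the fact unproved). [cite: Zhang2022LandauSiegel, §16 p.90 (u018)] -/
theorem _root_.Literature.NumberTheory.LFunctions.Zhang2022.Typed.Section16A.Step16_u018_holds :
    _root_.Literature.NumberTheory.LFunctions.Zhang2022.Typed.Section16A.Step16_u018 c' :=
  _root_.Literature.NumberTheory.LFunctions.Zhang2022.Typed.Section16A.step16_u018_holds (c' := c')

end Main

end Literature.NumberTheory.LFunctions.Zhang2022.Typed.Section16A

end
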